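/-
Copyright (c) 2026 the pub-hodgecm-mathlib formalisation cell (harness21).  Prover seat hodgecm-mathlib-K2E3-p25 (g2), HCML Track B «K2-LIT»,
h413 = `stmt-HodgeConjecture-24833`, road (11-3-split-nsc), leaf (nsc-S-A′), brick (E4b-1γ, part 3b = Haar on `U_P` from `F²` and the averaging projector as an
`F²`-integral) of the weak cell lemma (dealer D105′).  2026-09-04.
-/
import Summits.HodgeConjecture.HodgeConjecture.Theorems.K2E3GL3BorelInducedJacquetQOpenCellAlgebra     -- ★ part 2a: `uP_*`, `exists_eq_uP`, `continuous_uP`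
import Summits.HodgeConjecture.HodgeConjecture.Theorems.K2E3CompactOpenAverageIntegral              -- ★ (E4b-τ) `toFun_avgProj_map_subtype_eq_inv_smul_setIntegral`
import Literature.NumberTheory.Weil1964.LocalLinearChangeOfVariables                                 -- Haar on `F`, product measures (★ instances used in part 2b)
import HarnessLib

/-!
# K2_E3 road (h413), leaf (nsc-S-A′), brick E4b-1γ part 3b — the averaging projector `e_K` over a lattice `K = n(L) ≤ U_P` as an integral over `L ⊆ F²`

Cell `pub/hodgecm-mathlib` (D-0151), Track B, seat K2E3-p25 (g2).  `--supports stmt-HodgeConjecture-24833 --as helper`; THEOREMS ONLY (no `def`, no instance, no notation,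
no `sorry`); never imports `Cruxes/…/Lines`.  COUNT-NEUTRAL.

THE MATHEMATICS ([BernsteinZelevinsky1976, §1.18–1.19, 2.33]; [Casselman1995, §2.1]).  `n : F² → U_P`, `v ↦ n(v₀, v₁) = t₀₂(v₀) t₁₂(v₁)`, is an isomorphism of topological
groups (additive to multiplicative; ★ part 2a), so the image `μ_U` of the product Haar measure `μ ⊗ μ` is a left-invariant measure on `U_P`, finite on compacts and
positive on opens; for a compact open additive subgroup `L ≤ F²` its image `K = n(L)` is a compact open subgroup of `U_P`, and K2E3-p14 (g7)'s ★
`toFun_avgProj_map_subtype_eq_inv_smul_setIntegral` becomes **`exists_avgProj_eq_smul_setIntegral`**: there is `c ≠ 0` with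
`(e_K f)(x) = c · ∫_{v ∈ L} f(x · n(v)) d(μ ⊗ μ)(v)` for every `f ∈ Ind_B^{GL₃} σ′` and every `x`.  Part 3c evaluates these integrals on the open cell.

HONEST LABEL: HC_CM is proved only modulo the 7 printed citations (2 remaining named inputs: hLiu418 = stmt-HodgeConjecture-24832, h413 = stmt-HodgeConjecture-24833) until rung 0
closes; count-neutral helper.

## References
* [BernsteinZelevinsky1976] I. N. Bernstein, A. V. Zelevinsky, *Representations of the group GL(n,F)…*, Russian Math. Surveys 31 (1976), §1.18–1.19, 2.33.
* [Casselman1995] W. Casselman, *Introduction to the theory of admissible representations of p-adic reductive groups* (draft 1995), §2.1.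
-/

set_option autoImplicit false
set_option linter.dupNamespace false

noncomputable section

open Function Representation MeasureTheory
open scoped MatrixGroups NNReal
open Literature.NumberTheory.Automorphic Literature.NumberTheory.GaloisRepresentations.IsNonarchimedeanLocalField
open Summit.HodgeConjecture.HodgeConjecture.Cruxes.H413.K2E3GL3BorelInducedJacquetQOpenCellAlgebra
open Summit.HodgeConjecture.HodgeConjecture.Cruxes.H413.K2E3CompactOpenAverageIntegral

namespace Summit.HodgeConjecture.HodgeConjecture.Cruxes.H413.K2E3GL3BorelInducedJacquetQOpenCellHaar

variable {F : Type} [Field F] [ValuativeRel F] [TopologicalSpace F] [IsNonarchimedeanLocalField F] [MeasurableSpace F] [BorelSpace F]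
  (μ : Measure F) [μ.IsAddHaarMeasure]
  (h02 : (0 : Fin 3) ≠ 2) (h12 : (1 : Fin 3) ≠ 2)
  (σ' : Representation ℂ ↥(standardParabolicGL F (id : Fin 3 → Fin 3)) ℂ)

/-- **THE AVERAGING PROJECTOR OVER `n(L)` AS AN `F²`-INTEGRAL.**  For a compact open additive subgroup `L ≤ F²` there are a compact subgroup `K ≤ U_P` of `GL₃(F)`
containing `n(L)` and contained in it, and a constant `c ≠ 0`, with `(e_K f)(x) = c · ∫_{v ∈ L} f(x·n(v)) d(μ⊗μ)` for all `f ∈ Ind_B^{GL₃} σ′`, all `x`.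
[cite: BernsteinZelevinsky1976, 2.33] [cite: Casselman1995, §2.1] -/
theorem exists_avgProj_eq_smul_setIntegral (L : AddSubgroup (Fin 2 → F)) (hLo : IsOpen (L : Set (Fin 2 → F))) (hLc : IsCompact (L : Set (Fin 2 → F))) :
    ∃ (K : Subgroup (GL (Fin 3) F)) (c : ℝ), K ≤ unipotentRadicalGL F (![0, 0, 1] : Fin 3 → Fin 2) ∧ IsCompact (K : Set (GL (Fin 3) F)) ∧
      (∀ u, u ∈ K ↔ ∃ v ∈ L, u = transvectionUnit 0 2 h02 (v 0) * transvectionUnit 1 2 h12 (v 1)) ∧ c ≠ 0 ∧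
      ∀ (f : SmoothInd (standardParabolicGL F (id : Fin 3 → Fin 3)) σ') (x : GL (Fin 3) F),
        ((smoothIndRep (standardParabolicGL F (id : Fin 3 → Fin 3)) σ').avgProj K f).toFun x =
          c • ∫ v in (L : Set (Fin 2 → F)), f.toFun (x * (transvectionUnit 0 2 h02 (v 0) * transvectionUnit 1 2 h12 (v 1))) ∂(Measure.pi fun _ : Fin 2 => μ) := by
  haveI : IsTopologicalRing F := inferInstance
  haveI : T2Space F := (isLocalField F).toT2Space
  haveI : LocallyCompactSpace F := (isLocalField F).toLocallyCompactSpace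
  haveI : SecondCountableTopology F := secondCountableTopology_localField F
  -- the unipotent radical as a topological group, with its Borel structure
  set U : Subgroup (GL (Fin 3) F) := unipotentRadicalGL F (![0, 0, 1] : Fin 3 → Fin 2) with hU
  letI : MeasurableSpace ↥U := borel ↥U
  haveI : BorelSpace ↥U := ⟨rfl⟩
  -- `n : F² ≃ₜ U`
  let nU : (Fin 2 → F) ≃ₜ ↥U :=
    { toFun := fun v => ⟨transvectionUnit 0 2 h02 (v 0) * transvectionUnit 1 2 h12 (v 1), uP_mem_unipotentRadicalGL h02 h12 (v 0) (v 1)⟩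
      invFun := fun u => ![((u : GL (Fin 3) F) : Matrix (Fin 3) (Fin 3) F) 0 2, ((u : GL (Fin 3) F) : Matrix (Fin 3) (Fin 3) F) 1 2]
      left_inv := fun v => by
        ext i
        fin_cases i <;> simp [uP_apply]
      right_inv := fun u => by
        obtain ⟨a, b, hab⟩ := exists_eq_uP h02 h12 u.2
        apply Subtype.ext
        simp only [hab, uP_apply]
        simp
      continuous_toFun := (continuous_uP h02 h12).subtype_mk _
      continuous_invFun := by
        refine continuous_pi fun i => ?_
        fin_cases i
        · exact (Units.continuous_val.matrix_elem 0 2).comp continuous_subtype_val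
        · exact (Units.continuous_val.matrix_elem 1 2).comp continuous_subtype_val }
  have hnU : ∀ v, ((nU v : ↥U) : GL (Fin 3) F) = transvectionUnit 0 2 h02 (v 0) * transvectionUnit 1 2 h12 (v 1) := fun _ => rfl
  have hnU_add : ∀ v v', nU (v + v') = nU v * nU v' := fun v v' => Subtype.ext (uP_add h02 h12 (v 0) (v 1) (v' 0) (v' 1))
  have h0 : nU 0 = 1 := Subtype.ext (by rw [hnU]; simp [transvectionUnit_zero])
  -- the transported measure
  set μU : Measure ↥U := Measure.map nU (Measure.pi fun _ : Fin 2 => μ) with hμU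
  have hmeas : Measurable nU := nU.continuous.measurable
  haveI : μU.IsMulLeftInvariant := by
    refine ⟨fun h => ?_⟩
    obtain ⟨g, rfl⟩ : ∃ g, nU g = h := nU.surjective h
    rw [hμU, Measure.map_map (measurable_const_mul _) hmeas]
    conv_rhs => rw [← map_add_left_eq_self (Measure.pi fun _ : Fin 2 => μ) g]
    rw [Measure.map_map hmeas (measurable_const_add g)]
    congr 1
    ext v
    simp only [comp_apply, hnU_add, Subgroup.coe_mul]
  haveI : IsFiniteMeasureOnCompacts μU := by
    refine ⟨fun K hK => ?_⟩
    rw [hμU, Measure.map_apply hmeas hK.measurableSet]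
    exact (nU.isCompact_preimage.2 hK).measure_lt_top
  haveI : μU.IsOpenPosMeasure := nU.continuous.isOpenPosMeasure_map nU.surjective
  -- the subgroup `K = n(L)` of `U`
  let KU : Subgroup ↥U :=
    { carrier := {u | nU.symm u ∈ L}
      mul_mem' := fun {u u'} hu hu' => by
        change nU.symm (u * u') ∈ L
        have : u * u' = nU (nU.symm u + nU.symm u') := by rw [hnU_add, nU.apply_symm_apply, nU.apply_symm_apply]
        rw [this, nU.symm_apply_apply]
        exact L.add_mem hu hu'
      one_mem' := by
        change nU.symm 1 ∈ L
        rw [← h0, nU.symm_apply_apply]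
        exact L.zero_mem
      inv_mem' := fun {u} hu => by
        change nU.symm u⁻¹ ∈ L
        have h1 : u * nU (-nU.symm u) = 1 := by
          have := hnU_add (nU.symm u) (-nU.symm u)
          rw [add_neg_cancel, h0, nU.apply_symm_apply] at this
          exact this.symm
        rw [inv_eq_of_mul_eq_one_right h1, nU.symm_apply_apply]
        exact L.neg_mem hu }
  have hKU : ∀ u : ↥U, u ∈ KU ↔ nU.symm u ∈ L := fun _ => Iff.rfl
  have hKUset : (KU : Set ↥U) = nU.symm ⁻¹' (L : Set (Fin 2 → F)) := rfl
  have hKUo : IsOpen (KU : Set ↥U) := by rw [hKUset]; exact hLo.preimage nU.symm.continuous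
  have hKUc : IsCompact (KU : Set ↥U) := by
    rw [hKUset, ← Homeomorph.image_symm, Homeomorph.symm_symm]; exact hLc.image nU.continuous
  have hpre : nU ⁻¹' (KU : Set ↥U) = (L : Set (Fin 2 → F)) := by
    ext v; simp only [Set.mem_preimage, SetLike.mem_coe, hKU, Homeomorph.symm_apply_apply]
  -- the constant
  have hpos : 0 < μU.real (KU : Set ↥U) :=
    ENNReal.toReal_pos (hKUo.measure_pos μU ⟨1, KU.one_mem⟩).ne' hKUc.measure_lt_top.ne
  refine ⟨KU.map U.subtype, (μU.real (KU : Set ↥U))⁻¹, fun g hg => ?_, ?_, fun u => ?_, (inv_pos.2 hpos).ne', fun f x => ?_⟩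
  · obtain ⟨u, -, rfl⟩ := hg; exact u.2
  · rw [Subgroup.coe_map]; exact hKUc.image continuous_subtype_val
  · constructor
    · rintro ⟨u', hu', rfl⟩
      exact ⟨nU.symm u', hu', by rw [← hnU, nU.apply_symm_apply]; rfl⟩
    · rintro ⟨v, hv, rfl⟩
      exact ⟨nU v, by rw [SetLike.mem_coe, hKU, nU.symm_apply_apply]; exact hv, rfl⟩
  · rw [toFun_avgProj_map_subtype_eq_inv_smul_setIntegral (standardParabolicGL F (id : Fin 3 → Fin 3)) σ' U μU KU hKUc hKUo f x]
    congr 1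
    have hμU' : μU = Measure.map nU.toMeasurableEquiv (Measure.pi fun _ : Fin 2 => μ) := by
      rw [hμU, Homeomorph.toMeasurableEquiv_coe]
    rw [hμU', setIntegral_map_equiv, Homeomorph.toMeasurableEquiv_coe, hpre]
    rfl

end Summit.HodgeConjecture.HodgeConjecture.Cruxes.H413.K2E3GL3BorelInducedJacquetQOpenCellHaar

end
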